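import Summits.MatrixMultiplication.OmegaCensus.SmallFormats.MatMul22nRankGF7Slack5Search
import HarnessLib

/-!
# ω-census family (a): replay of the slack-5 search certificate, CHECK A part 9 of 12 (elements `224 ≤ h < 252`)

Cell `pub-omega` (unit `pub-omega-tensor-g16`), topic `Summits/MatrixMultiplication/OmegaCensus` (sub-folder `SmallFormats`).
Framing (verbatim): lottery ticket; floor = certified bounds/negative ranges. HONEST FRAMING: machine-generated kernel replay
(`pub-omega-tensor-g16/code/gen5_runs.py`): `levelsOK5n h = true` for the elements `224 ≤ h < 252` of `PGL₂(7)`: for every slot `(c, h)`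
(`c < 656`) and bucket level, if the key of its column is visited then the bucket holds an entry with that column (SIMD key planes,
`MatMul22nRankGF7Plane`). Meaning: `slotOK5_of_levelsOK5` (`MatMul22nRankGF7Slack5SearchSound`). Nothing here is progress on `ω`.
-/

namespace Summit.MatrixMultiplication.OmegaCensus.SmallFormats

set_option Elab.async false

set_option maxRecDepth 100000 in
set_option maxHeartbeats 400000000 in
/-- Elements `224 ≤ h < 228`. -/
theorem levelsOK5_ok_224_228 : ∀ h : Fin 336, 224 ≤ h.val → h.val < 228 → levelsOK5n h.val = true := by decide +kernel

set_option maxRecDepth 100000 in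
set_option maxHeartbeats 400000000 in
/-- Elements `228 ≤ h < 232`. -/
theorem levelsOK5_ok_228_232 : ∀ h : Fin 336, 228 ≤ h.val → h.val < 232 → levelsOK5n h.val = true := by decide +kernel

set_option maxRecDepth 100000 in
set_option maxHeartbeats 400000000 in
/-- Elements `232 ≤ h < 236`. -/
theorem levelsOK5_ok_232_236 : ∀ h : Fin 336, 232 ≤ h.val → h.val < 236 → levelsOK5n h.val = true := by decide +kernel

set_option maxRecDepth 100000 in
set_option maxHeartbeats 400000000 in
/-- Elements `236 ≤ h < 240`. -/
theorem levelsOK5_ok_236_240 : ∀ h : Fin 336, 236 ≤ h.val → h.val < 240 → levelsOK5n h.val = true := by decide +kernel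

set_option maxRecDepth 100000 in
set_option maxHeartbeats 400000000 in
/-- Elements `240 ≤ h < 244`. -/
theorem levelsOK5_ok_240_244 : ∀ h : Fin 336, 240 ≤ h.val → h.val < 244 → levelsOK5n h.val = true := by decide +kernel

set_option maxRecDepth 100000 in
set_option maxHeartbeats 400000000 in
/-- Elements `244 ≤ h < 248`. -/
theorem levelsOK5_ok_244_248 : ∀ h : Fin 336, 244 ≤ h.val → h.val < 248 → levelsOK5n h.val = true := by decide +kernel

set_option maxRecDepth 100000 in
set_option maxHeartbeats 400000000 in
/-- Elements `248 ≤ h < 252`. -/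
theorem levelsOK5_ok_248_252 : ∀ h : Fin 336, 248 ≤ h.val → h.val < 252 → levelsOK5n h.val = true := by decide +kernel

/-- CHECK A for the elements `224 ≤ h < 252`. -/
theorem levelsOK5_run_9 : ∀ h : Fin 336, 224 ≤ h.val → h.val < 252 → levelsOK5n h.val = true := by
  intro h hlo hhi
  by_cases h228 : h.val < 228
  · exact levelsOK5_ok_224_228 h (by omega) h228
  by_cases h232 : h.val < 232
  · exact levelsOK5_ok_228_232 h (by omega) h232
  by_cases h236 : h.val < 236
  · exact levelsOK5_ok_232_236 h (by omega) h236
  by_cases h240 : h.val < 240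
  · exact levelsOK5_ok_236_240 h (by omega) h240
  by_cases h244 : h.val < 244
  · exact levelsOK5_ok_240_244 h (by omega) h244
  by_cases h248 : h.val < 248
  · exact levelsOK5_ok_244_248 h (by omega) h248
  exact levelsOK5_ok_248_252 h (by omega) hhi

end Summit.MatrixMultiplication.OmegaCensus.SmallFormats
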